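import Summits.BirchSwinnertonDyer.BirchSwinnertonDyer.Theorems.ThetaPartnerAtTwoSignedControlAtTwoShaThreeAssembly
import Literature.NumberTheory.GaloisRepresentations.GaloisSubgroups
import Literature.NumberTheory.GaloisRepresentations.InducedGaloisRep
import Mathlib.GroupTheory.Sylow
import HarnessLib

/-!
# The odd-degree `2`-Sylow splitting field, and Milne I Thm. 4.10 (c)₃ from the order-`2` base case alone
# (K4 `SignedControlAtTwo` stub 3 `stub_poitouTateThreeRealRat`)

Route `ThetaPartnerAtTwo` (TP2; crux shared with `ResidualThetaTransportAtTwo`), crux K4 `SignedControlAtTwo`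
(stmt-BirchSwinnertonDyer-20309), line `eulerchar` v12, registered stub
`stub_poitouTateThreeRealRat : poitouTate_three_realPlaces_injective ℚ`.  Seat `prover-bsd-wall-tp2-p3` (lead, gen 5).
Brick B5 of the lead's dévissage: discharge of the Galois-theoretic hypothesis (hSyl) of B4 (`…ShaThreeAssembly`).

* §1 `exists_oddDegree_twoSylow_splittingField` — for a number field `K` and an open normal subgroup `U ⊴ Γ_K` there
  is a finite extension `F/K` of ODD degree and a normal subgroup `N₀ ⊴ Γ_F` of finite `2`-power index with
  `res(N₀) ≤ U`: take a finite Galois `L₁ ⊆ K̄` with `Gal(K̄/L₁) ≤ U` (tree `exists_finiteDimensional_isGalois_galFixing_subset`),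
  a `2`-Sylow subgroup `P` of `Gal(L₁/K)`, `F = L₁^P` (degree `[Gal(L₁/K) : P]`, odd), and `N₀ = res⁻¹(Gal(K̄/L₁))`
  (index `#P`, because `Gal(K̄/L₁) ≤ res(Γ_F)`: the embedded copy `e(F) ⊆ K̄` lies in the normal `L₁`).
* §2 `poitouTate_three_realPlaces_injective_of_base` — **the named fact `poitouTate_three_realPlaces_injective K`
  (Milne I Thm. 4.10 (c), `r = 3`, injectivity) for every number field `K`, from exactly two displayed inputs**:
  (hbase) real-place injectivity of `H³(F, T)` for every number field `F` and every TRIVIAL `Γ_F`-module `T` of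
  order `2` — the class-field-theoretic base case (`Br(F)/2 ≅ ⊕_{real} ℤ/2` by Brauer–Hasse–Noether with
  `H³(F, 𝔾_m)[2] = 0`; NOT proved here) — and (h416) Milne I Cor. 4.16 `poitouTate_two_realPlaces_surjective F` for every
  number field `F` (width seat w2's lane).  `= B4.poitouTate_three_realPlaces_injective_of_devissage` + §1.

HONEST FRAMING: THEOREMS ONLY (no definition, no named fact, no `sorry`); §2 is CONDITIONAL on (hbase) and (h416); closes
no item by itself (K4's stub 3 is the instance `K = ℚ`, still behind (hbase) and (h416)); BSD is not proved by any of this.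

References: [MilneADT2006] I Thm. 4.10 (c), Cor. 4.16; [SerreGaloisCohomology1997] I §3.3 (reduction to a Sylow
subgroup), II §4.4; [NeukirchANT1999] Ch. IV §1.
-/

set_option autoImplicit false
-- the Theorems namespace of this sub repeats the summit name by design (D-0017 nested layout)
set_option linter.dupNamespace false

noncomputable section

open CategoryTheory NumberField Field Function IntermediateField
open _root_.TopRep _root_.ContRepresentation _root_.ContinuousCohomology
open Literature.NumberTheory.GaloisRepresentations
open Literature.NumberTheory.GaloisRepresentations.LocalWeilDatum
open Literature.NumberTheory.GaloisCohomology

namespace Summit.BirchSwinnertonDyer.BirchSwinnertonDyer.Theorems.SignedEC.ShaThree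

/-! ## §1 The odd-degree `2`-Sylow splitting field -/

section Sylow

variable (K : Type) [Field K] [NumberField K]

omit [NumberField K] in
/-- **`Gal(K̄/L₁) ≤ res(Γ_F)` for a subfield `F ⊆ L₁` of a finite NORMAL `L₁ ⊆ K̄`**: the embedded copy `e(F)` of the
abstract field `F` (tree `absEmbedding`) lies in `L₁` (its elements are `K`-conjugates of elements of `L₁`), so
everything fixing `L₁` fixes `e(F)` (`mem_range_absGaloisRestrict_iff_smul_absEmbedding`). [cite: NeukirchANT1999, Ch. IV §1] -/
theorem galFixing_le_range_absGaloisRestrict (L₁ : IntermediateField K (AlgebraicClosure K))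
    [FiniteDimensional K L₁] [Normal K L₁] (F₀ : IntermediateField K L₁) :
    galFixing K L₁ ≤ (absGaloisRestrict K (lift F₀)).range := by
  intro g hg
  haveI : FiniteDimensional K (lift F₀) := (liftAlgEquiv F₀).toLinearEquiv.finiteDimensional
  haveI : Algebra.IsAlgebraic K (lift F₀) := Algebra.IsAlgebraic.of_finite K _
  rw [mem_range_absGaloisRestrict_iff_smul_absEmbedding]
  intro x
  -- `e x ∈ L₁`
  have hmem : absEmbedding K (lift F₀) x ∈ L₁ := by
    have hint : IsIntegral K (absEmbedding K (lift F₀) x) := Algebra.IsIntegral.isIntegral _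
    refine hint.mem_intermediateField_of_minpoly_splits ?_
    have hxL : ((x : lift F₀) : AlgebraicClosure K) ∈ L₁ := lift_le F₀ x.2
    have h1 : minpoly K (absEmbedding K (lift F₀) x) = minpoly K x :=
      minpoly.algHom_eq _ (absEmbedding K (lift F₀)).injective x
    have h2 : minpoly K x = minpoly K ((x : lift F₀) : AlgebraicClosure K) :=
      (minpoly.algHom_eq (lift F₀).val Subtype.val_injective x).symm
    have h3 : minpoly K (⟨(x : AlgebraicClosure K), hxL⟩ : L₁) = minpoly K ((x : lift F₀) : AlgebraicClosure K) :=
      (minpoly.algHom_eq L₁.val Subtype.val_injective ⟨(x : AlgebraicClosure K), hxL⟩).symm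
    rw [h1, h2, ← h3]
    exact Normal.splits inferInstance _
  exact (mem_galFixing_iff K).1 hg _ hmem

/-- **The odd-degree `2`-Sylow splitting field.**  For a number field `K` and an open normal subgroup `U ⊴ Γ_K`
there are a finite extension `F/K` of odd degree and a normal subgroup `N₀ ⊴ Γ_F` of finite `2`-power index whose
image under `res : Γ_F → Γ_K` lies in `U` (`F` = fixed field of a `2`-Sylow subgroup of `Gal(L₁/K)` for a finite Galois
`L₁` with `Gal(K̄/L₁) ≤ U`; `N₀ = res⁻¹ Gal(K̄/L₁)`).  This is hypothesis (hSyl) of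
`poitouTate_three_realPlaces_injective_of_devissage`. [cite: SerreGaloisCohomology1997, I §3.3] [cite: NeukirchANT1999, Ch. IV §1] -/
theorem exists_oddDegree_twoSylow_splittingField (U : Subgroup (absoluteGaloisGroup K)) [U.Normal]
    (hU : IsOpen (U : Set (absoluteGaloisGroup K))) :
    ∃ (F : Type) (_ : Field F) (_ : NumberField F) (_ : Algebra K F) (_ : FiniteDimensional K F)
      (N₀ : Subgroup (absoluteGaloisGroup F)) (_ : N₀.Normal) (_ : Finite (absoluteGaloisGroup F ⧸ N₀)),
      Odd (Module.finrank K F) ∧ IsPGroup 2 (absoluteGaloisGroup F ⧸ N₀) ∧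
        N₀ ≤ U.comap (absGaloisRestrict K F : absoluteGaloisGroup F →* absoluteGaloisGroup K) := by
  classical
  haveI : CompactSpace (absoluteGaloisGroup K) := absoluteGaloisGroup_compactSpace K
  obtain ⟨L₁, hfin, hgal, hL₁U⟩ := exists_finiteDimensional_isGalois_galFixing_subset (hU.mem_nhds U.one_mem)
  haveI := hfin
  haveI := hgal
  -- a `2`-Sylow subgroup `P` of `A = Gal(L₁/K)` and its fixed field
  obtain ⟨P⟩ : Nonempty (Sylow 2 (L₁ ≃ₐ[K] L₁)) := inferInstance
  let F₀ : IntermediateField K L₁ := fixedField (P : Subgroup (L₁ ≃ₐ[K] L₁))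
  let F : IntermediateField K (AlgebraicClosure K) := lift F₀
  haveI : FiniteDimensional K F := (liftAlgEquiv F₀).toLinearEquiv.finiteDimensional
  haveI : NumberField F := NumberField.of_module_finite K F
  -- degree `[F : K] = [A : P]`, odd
  have hcardA : Nat.card (L₁ ≃ₐ[K] L₁) = Module.finrank K L₁ := IsGalois.card_aut_eq_finrank K L₁
  have hdeg0 : Module.finrank K F₀ = (P : Subgroup (L₁ ≃ₐ[K] L₁)).index := by
    have htower := Module.finrank_mul_finrank K F₀ L₁
    rw [finrank_fixedField_eq_card, ← hcardA, ← (P : Subgroup (L₁ ≃ₐ[K] L₁)).index_mul_card] at htower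
    exact Nat.eq_of_mul_eq_mul_right Nat.card_pos htower
  have hdeg : Module.finrank K F = (P : Subgroup (L₁ ≃ₐ[K] L₁)).index := by
    rw [← hdeg0]
    exact (liftAlgEquiv F₀).symm.toLinearEquiv.finrank_eq
  have hodd : Odd (Module.finrank K F) := by
    rw [hdeg, ← Nat.coprime_two_right]
    exact (Nat.coprime_comm).1 ((Nat.Prime.coprime_iff_not_dvd Nat.prime_two).2 P.not_dvd_index)
  -- `N₀ = res⁻¹ Gal(K̄/L₁)`
  let N₀ : Subgroup (absoluteGaloisGroup F) := (galFixing K L₁).comap (absGaloisRestrict K F).toMonoidHom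
  haveI hnormal : (galFixing K L₁).Normal := by rw [← ker_resGal L₁]; exact MonoidHom.normal_ker _
  haveI : N₀.Normal := Subgroup.Normal.comap hnormal _
  -- its index is `#P`, a power of `2`
  have hle : galFixing K L₁ ≤ (absGaloisRestrict K F).range := galFixing_le_range_absGaloisRestrict K L₁ F₀
  have hindexU : (galFixing K L₁).index = Nat.card (L₁ ≃ₐ[K] L₁) := by
    rw [← ker_resGal L₁, Subgroup.index_ker, MonoidHom.range_eq_top.2 (resGal_surjective L₁), Subgroup.card_top]
  have hindexR : (absGaloisRestrict K F).range.index = (P : Subgroup (L₁ ≃ₐ[K] L₁)).index := by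
    rw [index_range_absGaloisRestrict, hdeg]
  have hidx0 : (P : Subgroup (L₁ ≃ₐ[K] L₁)).index ≠ 0 := Subgroup.index_ne_zero_of_finite
  have hN₀index : N₀.index = Nat.card (P : Subgroup (L₁ ≃ₐ[K] L₁)) := by
    have h := Subgroup.relIndex_mul_index hle
    rw [hindexU, hindexR, ← (P : Subgroup (L₁ ≃ₐ[K] L₁)).index_mul_card] at h
    -- h : rel * P.index = P.index * #P
    rw [Subgroup.index_comap]
    exact Nat.eq_of_mul_eq_mul_right (Nat.pos_of_ne_zero hidx0) (h.trans (mul_comm _ _))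
  obtain ⟨k, hk⟩ := P.isPGroup'.exists_card_eq
  have hN₀k : N₀.index = 2 ^ k := by rw [hN₀index, hk]
  haveI : N₀.FiniteIndex := ⟨by rw [hN₀k]; exact pow_ne_zero _ two_ne_zero⟩
  haveI : Finite (absoluteGaloisGroup F ⧸ N₀) := Subgroup.finite_quotient_of_finiteIndex
  have hQ : IsPGroup 2 (absoluteGaloisGroup F ⧸ N₀) :=
    IsPGroup.of_card (by rw [← Subgroup.index_eq_card, hN₀k] : Nat.card (absoluteGaloisGroup F ⧸ N₀) = 2 ^ k)
  refine ⟨F, inferInstance, inferInstance, inferInstance, inferInstance, N₀, inferInstance, inferInstance, hodd, hQ,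
    ?_⟩
  exact Subgroup.comap_mono (fun g hg => hL₁U hg)

end Sylow

/-! ## §2 Milne I Thm. 4.10 (c)₃ from the order-`2` base case and Cor. 4.16 -/

section Final

/-- **Milne I Thm. 4.10 (c), `r = 3`, injectivity — `poitouTate_three_realPlaces_injective K` for EVERY number field
`K` — from the base case at the trivial module of order `2` and Milne I Cor. 4.16**: (hbase) for every number field
`F` and every discrete `Γ_F`-module `T` of order `2` with trivial action, a class of `H³(F, T)` vanishing at all real
places of `F` is `0`; (h416) `poitouTate_two_realPlaces_surjective F` for every number field `F`.  (Dévissage: odd part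
by `cd_p ≤ 2`, `2`-part by odd-degree descent to a `2`-Sylow splitting field and filtration by stable lines, the
extension step at each stage.) [cite: MilneADT2006, Ch. I, Thm. 4.10 (c) and Cor. 4.16]
[cite: SerreGaloisCohomology1997, I §3.3 and II §4.4 Prop. 13] -/
theorem poitouTate_three_realPlaces_injective_of_base (K : Type) [Field K] [NumberField K]
    (hbase : ∀ (F : Type) [Field F] [NumberField F] (T : Type) [AddCommGroup T] [TopologicalSpace T]
      [DiscreteTopology T] [Finite T] (σ : DiscreteGaloisModule F T),
      (∀ (g : absoluteGaloisGroup F) (t : T), σ g t = t) → Nat.card T = 2 →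
        ∀ c : galoisCohomology σ 3,
          (∀ w : InfinitePlace F, w.IsReal → galoisCohomology.localization σ (Sum.inl w) 3 c = 0) → c = 0)
    (h416 : ∀ (F : Type) [Field F] [NumberField F], poitouTate_two_realPlaces_surjective F) :
    poitouTate_three_realPlaces_injective K :=
  poitouTate_three_realPlaces_injective_of_devissage
    (fun U hUn hU => by haveI := hUn; exact exists_oddDegree_twoSylow_splittingField K U hU) hbase h416

end Final

end Summit.BirchSwinnertonDyer.BirchSwinnertonDyer.Theorems.SignedEC.ShaThree

end
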